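import Literature.NumberTheory.Automorphic.RelNormOneTorusArchCircles
import Literature.NumberTheory.Automorphic.UnitaryLineCharacters
import Literature.NumberTheory.Automorphic.UnitaryGroupArchCenter
import Literature.NumberTheory.Automorphic.UnitaryGroupArchDet
import Literature.NumberTheory.GelbartRogawski1991.CompatibleSplittingTwistVacuumShift
import HarnessLib

/-!
# Automatic continuity on the divisible archimedean torus `U(1)(L⁺ ⊗ ℝ)` and on `U(H)(L ⊗ ℝ)` from its centre

Topic `NumberTheory/Automorphic`; namespaces `Literature.NumberTheory.Automorphic` (§1–§2) and
`Literature.NumberTheory.Automorphic.UnitaryGroup` (§3).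

For a CM field `L` with maximal totally real subfield `L⁺` the archimedean norm-one torus
`U(1)(L⁺ ⊗ ℝ) = relNormOneInfUnits L⁺ L ≅ ∏_{w ∣ ∞} U(1)` (files `RelNormOneTorusArch`,
`RelNormOneTorusArchCircles`) is a compact connected abelian Lie group, hence DIVISIBLE: every `n`-th power
map `t ↦ t ^ n` (`n ≠ 0`) is onto.  The point of this file is the following soft consequence, which needs no
classification of the characters of `U(1)`:

* §1 (`isQuotientMap_pow_of_surjective`, `continuous_of_continuous_comp_pow`): on a compact Hausdorff
  topological monoid `T` a SURJECTIVE power map `p_n : t ↦ t ^ n` is continuous and closed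
  [cite: Bourbaki1995, Ch. I §9 no. 4 Cor. 2] (Mathlib `Continuous.isClosedMap`), hence a quotient map
  (`IsClosedMap.isQuotientMap`); so ANY map `f : T → X` with `f ∘ p_n` continuous is continuous
  [cite: Bourbaki1995, Ch. I §3 no. 4 Prop. 6] (`IsQuotientMap.continuous_iff`), and in particular
  an abstract homomorphism `ζ : T →* H` into any topological monoid with `t ↦ (ζ t) ^ n` continuous is continuous
  (`continuous_of_continuous_pow_apply`, `continuous_of_pow_apply_eq`);
* §2 (`relNormOneInfUnits_pow_surjective`, `continuous_of_continuous_pow_relNormOneInfUnits`,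
  `continuous_of_pow_eq_archWeight`): the CM torus has surjective `n`-th power (`Circle.exp_surjective` through
  the tree's `relNormOneInfUnitsMulEquivCircles`), so **an abstract character of `U(1)(L⁺ ⊗ ℝ)` one of whose
  non-trivial powers is continuous — e.g. equal to a typed weight `archWeight L m` — is continuous**;
* §3 (`archDet_archCenter`, `cmArchDet_surjective`, `exists_continuous_comp_cmArchDet_eq`,
  `continuous_of_trivial_on_ker_cmArchDet`, `continuous_of_comp_cmArchDet_eq`): for a hermitian form `H ∈ M_N(L)`, `det H ≠ 0`, `N ≠ 0`, the
  determinant of the archimedean centre is the `N`-th power, `det_∞ (y · 1_N) = y ^ N` (tree `cmArchDet`,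
  `cmArchCenter`), so `det_∞` is onto, and **an abstract homomorphism `χ : U(H)(L ⊗ ℝ) →* A` (any topological
  monoid `A`) which is trivial on `ker det_∞` and continuous on the centre `y · 1_N` is `α ∘ det_∞` for a
  CONTINUOUS `α : U(1)(L⁺ ⊗ ℝ) →* A`, hence continuous** — the archimedean continuity of a central-type twist is
  read off its restriction to the centre;
* §4 (`cmArchDet_eq_one_iff`, `forall_map_eq_one_of_cmArchDet_eq_one`, `exists_continuous_comp_cmArchDet_eq'`,
  `continuous_of_forall_det_eq_one`): `det_∞ g = 1 ↔ det g_w = 1` at every complex place `w`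
  (`g_w = archPiEquivCM N L H g w`; tree `coe_archPlaceChar_cmArchDet`, whence the import of
  `GelbartRogawski1991.CompatibleSplittingTwistVacuumShift`), so the hypothesis `hker` may be supplied in the
  place-wise shape "`χ a = 1` whenever every complex component of `a` has determinant `1`" — the output shape of a
  place-by-place perfectness argument — and §3 restated in that shape.

Everything is proved (Mathlib + tree); KERNEL ONLY: 0 records, 0 named facts, 0 sorry.  The algebraic input
"`χ` is trivial on `ker det_∞`" (perfectness of the groups `SU(σ_w H)(ℂ)`) is NOT proved here: it enters as the
displayed hypothesis `hker` (§3) / `hSU` (§4).  Model-construction cell pub-hodgecm (theta supply lineage, count-neutral); nothing here is a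
claim of the manuscripts adjudicated by that cell.

References: N. Bourbaki, *General Topology, Chapters 1–4* (1995), Ch. I §3 no. 4 Prop. 6 (universal property
of quotient maps) and Ch. I §9 no. 4, Théorème 2 Cor. 2 (continuous maps from quasi-compact to Hausdorff spaces are
closed) [cite: Bourbaki1995, Ch. I §9 no. 4 Cor. 2]; C. P. Mok, *Endoscopic classification of representations of
quasi-split unitary groups*, Mem. AMS 235 (2015), §1 Notation p. 5 (`det : U(N) → U(1)`)
[cite: Mok2014, §1 Notation p. 5]; V. Platonov, A. Rapinchuk, *Algebraic groups and number theory*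
(1994), §6.2 (the norm-one torus) [cite: PlatonovRapinchuk1994, §6.2]; A. Borel, H. Jacquet, *Automorphic forms
and automorphic representations*, Proc. Sympos. Pure Math. 33 (1979), §4.1 (the archimedean component and its
centre) [cite: BorelJacquet1979, §4.1].
-/

set_option autoImplicit false

noncomputable section

open _root_.Topology _root_.Function
open NumberField NumberField.InfinitePlace

namespace Literature.NumberTheory.Automorphic

/-! ## §1. A surjective power map of a compact Hausdorff monoid is a quotient map -/

section PowQuotient

variable {T : Type*} [Monoid T] [TopologicalSpace T] [ContinuousMul T] [CompactSpace T] [T2Space T]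

/-- **A surjective power map `t ↦ t ^ n` of a compact Hausdorff topological monoid is a quotient map**: it is
continuous and closed (compact → Hausdorff). [cite: Bourbaki1995, Ch. I §9 no. 4 Cor. 2] -/
theorem isQuotientMap_pow_of_surjective (n : ℕ) (hn : Surjective fun t : T => t ^ n) :
    IsQuotientMap fun t : T => t ^ n :=
  (continuous_pow n).isClosedMap.isQuotientMap (continuous_pow n) hn

/-- A map out of a compact Hausdorff monoid with surjective `n`-th power is continuous as soon as its composite
with `t ↦ t ^ n` is (universal property of the quotient map `t ↦ t ^ n`). [cite: Bourbaki1995, Ch. I §3 no. 4 Prop. 6] -/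
theorem continuous_of_continuous_comp_pow {X : Type*} [TopologicalSpace X] (n : ℕ)
    (hn : Surjective fun t : T => t ^ n) (f : T → X) (hf : Continuous fun t => f (t ^ n)) :
    Continuous f :=
  (isQuotientMap_pow_of_surjective n hn).continuous_iff.mpr hf

/-- **An abstract homomorphism `ζ` out of a compact Hausdorff monoid with surjective `n`-th power is continuous
as soon as `t ↦ (ζ t) ^ n` is** (`ζ (t ^ n) = (ζ t) ^ n`). [cite: Bourbaki1995, Ch. I §3 no. 4 Prop. 6] -/
theorem continuous_of_continuous_pow_apply {H : Type*} [Monoid H] [TopologicalSpace H] (n : ℕ)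
    (hn : Surjective fun t : T => t ^ n) (ζ : T →* H) (hζ : Continuous fun t => ζ t ^ n) :
    Continuous ζ :=
  continuous_of_continuous_comp_pow n hn ζ (by simpa only [map_pow] using hζ)

/-- The same with the `n`-th power identified with a given continuous map `θ`: `(ζ t) ^ n = θ t` for all `t`
and `θ` continuous imply `ζ` continuous. [cite: Bourbaki1995, Ch. I §3 no. 4 Prop. 6] -/
theorem continuous_of_pow_apply_eq {H : Type*} [Monoid H] [TopologicalSpace H] (n : ℕ)
    (hn : Surjective fun t : T => t ^ n) (ζ : T →* H) (θ : T → H) (hθ : Continuous θ)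
    (h : ∀ t, ζ t ^ n = θ t) : Continuous ζ :=
  continuous_of_continuous_pow_apply n hn ζ (by rw [show (fun t => ζ t ^ n) = θ from funext h]; exact hθ)

end PowQuotient

/-! ## §2. The CM archimedean torus `U(1)(L⁺ ⊗ ℝ) ≅ ∏_{w ∣ ∞} U(1)` is divisible -/

section CMTorus

variable (L : Type) [Field L] [NumberField L] [IsCMField L]

omit [NumberField L] [IsCMField L] in
/-- `U(1) ⊂ ℂ` is divisible: `z ↦ z ^ n` is onto for `n ≠ 0` (`z = exp(iθ) = exp(iθ/n) ^ n`). [folklore] -/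
private theorem circle_pow_surjective {n : ℕ} (hn : n ≠ 0) : Surjective fun z : Circle => z ^ n := by
  intro z
  obtain ⟨x, rfl⟩ := Circle.exp_surjective z
  refine ⟨Circle.exp (x / n), ?_⟩
  show Circle.exp (x / n) ^ n = Circle.exp x
  rw [← Circle.exp_natCast_mul, mul_div_cancel₀ _ (Nat.cast_ne_zero.mpr hn)]

/-- **The archimedean torus `U(1)(L⁺ ⊗ ℝ)` of a CM field is divisible**: `t ↦ t ^ n` is onto for `n ≠ 0`
(transport of `circle_pow_surjective` along `relNormOneInfUnits L⁺ L ≃* ∏_w U(1)`).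
[cite: PlatonovRapinchuk1994, §6.2] -/
theorem relNormOneInfUnits_pow_surjective {n : ℕ} (hn : n ≠ 0) :
    Surjective fun t : relNormOneInfUnits (maximalRealSubfield L) L => t ^ n := by
  intro t
  choose z hz using fun w => circle_pow_surjective hn (relNormOneInfUnitsMulEquivCircles L t w)
  refine ⟨(relNormOneInfUnitsMulEquivCircles L).symm z, ?_⟩
  apply (relNormOneInfUnitsMulEquivCircles L).injective
  show relNormOneInfUnitsMulEquivCircles L (((relNormOneInfUnitsMulEquivCircles L).symm z) ^ n) = _
  rw [map_pow, MulEquiv.apply_symm_apply]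
  exact funext hz

/-- The `n`-th power map of `U(1)(L⁺ ⊗ ℝ)` (`n ≠ 0`) is a quotient map (divisible compact torus
[cite: PlatonovRapinchuk1994, §6.2]; closed continuous surjection). [cite: Bourbaki1995, Ch. I §9 no. 4 Cor. 2] -/
theorem isQuotientMap_pow_relNormOneInfUnits {n : ℕ} (hn : n ≠ 0) :
    IsQuotientMap fun t : relNormOneInfUnits (maximalRealSubfield L) L => t ^ n :=
  isQuotientMap_pow_of_surjective n (relNormOneInfUnits_pow_surjective L hn)

/-- **Automatic continuity on `U(1)(L⁺ ⊗ ℝ)`**: an abstract homomorphism `ζ : U(1)(L⁺ ⊗ ℝ) →* H` into any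
topological monoid with `t ↦ (ζ t) ^ n` continuous for one `n ≠ 0` is continuous (divisibility of the torus
[cite: PlatonovRapinchuk1994, §6.2] and the universal property of the quotient map `t ↦ t ^ n`). [cite: Bourbaki1995, Ch. I §3 no. 4 Prop. 6] -/
theorem continuous_of_continuous_pow_relNormOneInfUnits {H : Type*} [Monoid H] [TopologicalSpace H] {n : ℕ}
    (hn : n ≠ 0) (ζ : relNormOneInfUnits (maximalRealSubfield L) L →* H) (hζ : Continuous fun t => ζ t ^ n) :
    Continuous ζ :=
  continuous_of_continuous_pow_apply n (relNormOneInfUnits_pow_surjective L hn) ζ hζ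

/-- The same with the power identified with a continuous map: `(ζ t) ^ n = θ t`, `θ` continuous, `n ≠ 0`.
[cite: Bourbaki1995, Ch. I §3 no. 4 Prop. 6] -/
theorem continuous_of_pow_apply_eq_relNormOneInfUnits {H : Type*} [Monoid H] [TopologicalSpace H] {n : ℕ}
    (hn : n ≠ 0) (ζ : relNormOneInfUnits (maximalRealSubfield L) L →* H)
    (θ : relNormOneInfUnits (maximalRealSubfield L) L → H) (hθ : Continuous θ) (h : ∀ t, ζ t ^ n = θ t) :
    Continuous ζ :=
  continuous_of_pow_apply_eq n (relNormOneInfUnits_pow_surjective L hn) ζ θ hθ h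

/-- **An abstract `ℂ`-valued character of `U(1)(L⁺ ⊗ ℝ)` with `ζ ^ n = archWeight L m` (`n ≠ 0`) is
continuous** (the typed weight is continuous, `continuous_archWeight`). [cite: Bourbaki1995, Ch. I §3 no. 4 Prop. 6] -/
theorem continuous_of_pow_eq_archWeight {n : ℕ} (hn : n ≠ 0)
    (ζ : relNormOneInfUnits (maximalRealSubfield L) L →* ℂ) (m : InfinitePlace L → ℤ)
    (h : ∀ t, ζ t ^ n = archWeight L m t) : Continuous ζ :=
  continuous_of_pow_apply_eq_relNormOneInfUnits L hn ζ (archWeight L m) (continuous_archWeight L m) h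

/-- The `ℂˣ`-valued form: `((ζ t) ^ n : ℂ) = archWeight L m t` for all `t` (`n ≠ 0`) implies `ζ` continuous
(`ℂˣ ↪ ℂ` is an embedding, Mathlib `Units.isEmbedding_val₀`). [cite: Bourbaki1995, Ch. I §3 no. 4 Prop. 6] -/
theorem continuous_of_pow_eq_archWeight_units {n : ℕ} (hn : n ≠ 0)
    (ζ : relNormOneInfUnits (maximalRealSubfield L) L →* ℂˣ) (m : InfinitePlace L → ℤ)
    (h : ∀ t, (((ζ t) ^ n : ℂˣ) : ℂ) = archWeight L m t) : Continuous ζ := by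
  refine continuous_of_continuous_pow_relNormOneInfUnits L hn ζ
    (Units.isEmbedding_val₀.continuous_iff.mpr ?_)
  show Continuous fun t => (((ζ t) ^ n : ℂˣ) : ℂ)
  simp only [h]
  exact continuous_archWeight L m

/-- The `Circle`-valued form: `(ζ t) ^ n = archWeightCircle L m t` for all `t` (`n ≠ 0`) implies `ζ`
continuous. [cite: Bourbaki1995, Ch. I §3 no. 4 Prop. 6] -/
theorem continuous_of_pow_eq_archWeightCircle {n : ℕ} (hn : n ≠ 0)
    (ζ : relNormOneInfUnits (maximalRealSubfield L) L →* Circle) (m : InfinitePlace L → ℤ)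
    (h : ∀ t, ζ t ^ n = archWeightCircle L m t) : Continuous ζ :=
  continuous_of_pow_apply_eq_relNormOneInfUnits L hn ζ (archWeightCircle L m) (continuous_archWeightCircle L m) h

end CMTorus

/-! ## §3. `U(H)(L ⊗ ℝ)`: `det_∞ (y · 1_N) = y ^ N`, and continuity from the centre -/

namespace UnitaryGroup

section Quadratic

variable (F E : Type) [Field F] [NumberField F] [Field E] [NumberField E] [Algebra F E]
variable (c : E ≃ₐ[F] E) (N : ℕ) (J : Matrix (Fin N) (Fin N) E)

/-- **`det_∞ (y · 1_N) = y ^ N`**: the determinant of the archimedean central element is the `N`-th power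
(general quadratic `E/F`, `c ≠ 1`, `det J ≠ 0`). [cite: BorelJacquet1979, §4.1] -/
theorem archDet_archCenter (h2 : Module.finrank F E = 2) (hc : c ≠ 1) (hJ : J.det ≠ 0)
    (y : relNormOneInfUnits F E) :
    archDet F E c N J h2 hc hJ (archCenter F E c N J h2 hc y) = y ^ N := by
  apply Subtype.ext
  apply Units.ext
  rw [coe_archDet, coe_archDetInf, coe_archCenter, Matrix.det_smul, Matrix.det_one, mul_one, Fintype.card_fin,
    map_pow, RingEquiv.symm_apply_apply, Subgroup.coe_pow, Units.val_pow_eq_pow_val]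

/-- a homomorphism of `U(J)(E ⊗ ℝ)` trivial on `ker det_∞` takes equal values at elements of equal
determinant. [folklore] -/
private theorem apply_eq_of_archDet_eq {A : Type*} [Monoid A] (h2 : Module.finrank F E = 2) (hc : c ≠ 1)
    (hJ : J.det ≠ 0) (χ : arch F E c N J →* A) (hker : ∀ g, archDet F E c N J h2 hc hJ g = 1 → χ g = 1)
    {g g' : arch F E c N J} (h : archDet F E c N J h2 hc hJ g = archDet F E c N J h2 hc hJ g') :
    χ g = χ g' := by
  have h1 : archDet F E c N J h2 hc hJ (g⁻¹ * g') = 1 := by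
    rw [map_mul, map_inv, h, inv_mul_cancel]
  calc χ g = χ g * χ (g⁻¹ * g') := by rw [hker _ h1, mul_one]
    _ = χ (g * (g⁻¹ * g')) := (map_mul χ _ _).symm
    _ = χ g' := by rw [mul_inv_cancel_left]

end Quadratic

section CM

variable (L : Type) [Field L] [NumberField L] [IsCMField L] (N : ℕ) (H : Matrix (Fin N) (Fin N) L)

/-- **`det_∞ (y · 1_N) = y ^ N`** at the CM pin (`cmArchDet`, `cmArchCenter`). [cite: BorelJacquet1979, §4.1] -/
theorem cmArchDet_cmArchCenter (hH : H.det ≠ 0) (y : relNormOneInfUnits (↥(maximalRealSubfield L)) L) :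
    cmArchDet L N H hH (cmArchCenter L N H y) = y ^ N :=
  archDet_archCenter _ L _ N H _ _ hH y

/-- **`det_∞ : U(H)(L ⊗ ℝ) → U(1)(L⁺ ⊗ ℝ)` is onto** for `N ≠ 0`, `det H ≠ 0` (already on the centre, by
divisibility of the torus [cite: PlatonovRapinchuk1994, §6.2]). [cite: Mok2014, §1 Notation p. 5] -/
theorem cmArchDet_surjective (hH : H.det ≠ 0) (hN : N ≠ 0) : Surjective (cmArchDet L N H hH) := fun t => by
  obtain ⟨s, hs⟩ := relNormOneInfUnits_pow_surjective L hN t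
  exact ⟨cmArchCenter L N H s, (cmArchDet_cmArchCenter L N H hH s).trans hs⟩

/-- CM form of `apply_eq_of_archDet_eq`. [folklore] -/
private theorem apply_eq_of_cmArchDet_eq {A : Type*} [Monoid A] (hH : H.det ≠ 0)
    (χ : arch (↥(maximalRealSubfield L)) L (IsCMField.complexConj L) N H →* A)
    (hker : ∀ g, cmArchDet L N H hH g = 1 → χ g = 1)
    {g g' : arch (↥(maximalRealSubfield L)) L (IsCMField.complexConj L) N H}
    (h : cmArchDet L N H hH g = cmArchDet L N H hH g') : χ g = χ g' :=
  apply_eq_of_archDet_eq _ L _ N H _ _ hH χ hker h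

/-- **Factorisation through `det_∞` with a CONTINUOUS character.**  Let `χ : U(H)(L ⊗ ℝ) →* A` be an abstract
homomorphism into a topological monoid, trivial on `ker det_∞`, whose restriction to the centre
`y ↦ χ (y · 1_N)` is continuous (`N ≠ 0`, `det H ≠ 0`).  Then `χ = α ∘ det_∞` for a continuous
`α : U(1)(L⁺ ⊗ ℝ) →* A` (`α ∘ (·) ^ N = χ ∘ centre`, and the power map of the divisible compact torus is a
quotient map, §2). [cite: Bourbaki1995, Ch. I §3 no. 4 Prop. 6] -/
theorem exists_continuous_comp_cmArchDet_eq {A : Type*} [Monoid A] [TopologicalSpace A] (hH : H.det ≠ 0)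
    (hN : N ≠ 0) (χ : arch (↥(maximalRealSubfield L)) L (IsCMField.complexConj L) N H →* A)
    (hker : ∀ g, cmArchDet L N H hH g = 1 → χ g = 1)
    (hcen : Continuous fun y => χ (cmArchCenter L N H y)) :
    ∃ α : relNormOneInfUnits (↥(maximalRealSubfield L)) L →* A,
      Continuous α ∧ χ = α.comp (cmArchDet L N H hH) := by
  have hσ : ∀ t, cmArchDet L N H hH (surjInv (cmArchDet_surjective L N H hH hN) t) = t :=
    surjInv_eq (cmArchDet_surjective L N H hH hN)
  let α : relNormOneInfUnits (↥(maximalRealSubfield L)) L →* A :=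
    { toFun := fun t => χ (surjInv (cmArchDet_surjective L N H hH hN) t)
      map_one' := hker _ (hσ 1)
      map_mul' := fun s t => by
        rw [← map_mul]
        exact apply_eq_of_cmArchDet_eq L N H hH χ hker (by rw [hσ, map_mul, hσ, hσ]) }
  have hα : ∀ t, α t = χ (surjInv (cmArchDet_surjective L N H hH hN) t) := fun _ => rfl
  refine ⟨α, ?_, ?_⟩
  · refine continuous_of_continuous_pow_relNormOneInfUnits L hN α ?_
    have key : (fun t => α t ^ N) = fun y => χ (cmArchCenter L N H y) := by
      funext y
      rw [← map_pow, hα]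
      exact apply_eq_of_cmArchDet_eq L N H hH χ hker (by rw [hσ, cmArchDet_cmArchCenter])
    rw [key]
    exact hcen
  · ext g
    rw [MonoidHom.comp_apply, hα]
    exact (apply_eq_of_cmArchDet_eq L N H hH χ hker (hσ (cmArchDet L N H hH g))).symm

/-- **Continuity from the centre.**  An abstract homomorphism `χ : U(H)(L ⊗ ℝ) →* A` into a topological monoid,
trivial on `ker det_∞` and continuous on the centre `y · 1_N`, is continuous (`N ≠ 0`, `det H ≠ 0`).
[cite: Bourbaki1995, Ch. I §3 no. 4 Prop. 6] -/
theorem continuous_of_trivial_on_ker_cmArchDet {A : Type*} [Monoid A] [TopologicalSpace A] (hH : H.det ≠ 0)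
    (hN : N ≠ 0) (χ : arch (↥(maximalRealSubfield L)) L (IsCMField.complexConj L) N H →* A)
    (hker : ∀ g, cmArchDet L N H hH g = 1 → χ g = 1)
    (hcen : Continuous fun y => χ (cmArchCenter L N H y)) : Continuous χ := by
  obtain ⟨α, hα, hfac⟩ := exists_continuous_comp_cmArchDet_eq L N H hH hN χ hker hcen
  rw [hfac]
  exact hα.comp (continuous_cmArchDet L N H hH)

/-- **Continuity of a given `det_∞`-factorisation.**  If `χ = α ∘ det_∞` (abstractly) and `χ` is continuous on
the centre, then `α` is continuous (`α (y ^ N) = χ (y · 1_N)` and §2), and so is `χ`. [cite: Bourbaki1995, Ch. I §3 no. 4 Prop. 6] -/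
theorem continuous_of_comp_cmArchDet_eq {A : Type*} [Monoid A] [TopologicalSpace A] (hH : H.det ≠ 0)
    (hN : N ≠ 0) (χ : arch (↥(maximalRealSubfield L)) L (IsCMField.complexConj L) N H →* A)
    (α : relNormOneInfUnits (↥(maximalRealSubfield L)) L →* A) (hfac : χ = α.comp (cmArchDet L N H hH))
    (hcen : Continuous fun y => χ (cmArchCenter L N H y)) : Continuous α ∧ Continuous χ := by
  have hα : Continuous α := by
    refine continuous_of_continuous_pow_relNormOneInfUnits L hN α ?_
    have key : (fun t => α t ^ N) = fun y => χ (cmArchCenter L N H y) := by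
      funext y
      rw [← map_pow, ← cmArchDet_cmArchCenter L N H hH y, hfac, MonoidHom.comp_apply]
    rw [key]
    exact hcen
  refine ⟨hα, ?_⟩
  rw [hfac]
  exact hα.comp (continuous_cmArchDet L N H hH)

/-! ## §4. `ker det_∞` in place components: `det_∞ g = 1 ↔ det g_w = 1` for all `w ∣ ∞`

The hypothesis `hker` above is usually discharged place by place (perfectness of each `SU(σ_w H)(ℂ)`), in
the shape "`χ a = 1` whenever every complex component `a_w = archPiEquivCM N L H a w` has determinant `1`".
The following lemmas convert between that shape and `det_∞ a = 1` (tree `coe_archPlaceChar_cmArchDet`: the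
`w`-component of `det_∞ a` is `det a_w`; `archPlaceChars_injective`). -/

/-- Components of `archPiEquivCM` are the place projections `archAt`. [cite: BorelJacquet1979, §4.1] -/
@[simp] theorem archPiEquivCM_apply (g : arch (↥(maximalRealSubfield L)) L (IsCMField.complexConj L) N H)
    (w : {w : InfinitePlace L // IsComplex w}) :
    archPiEquivCM N L H g w = archAt (↥(maximalRealSubfield L)) L (IsCMField.complexConj L) N H w
      (complexConj_smul_infinitePlace L w.1) (IsCMField.complexConj_ne_one L) g := rfl

/-- **`det_∞ g = 1` iff every complex component `g_w` has determinant `1`.** [cite: BorelJacquet1979, §4.1] -/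
theorem cmArchDet_eq_one_iff (hH : H.det ≠ 0)
    (g : arch (↥(maximalRealSubfield L)) L (IsCMField.complexConj L) N H) :
    cmArchDet L N H hH g = 1 ↔ ∀ w : {w : InfinitePlace L // IsComplex w},
      (((archPiEquivCM N L H g w : archLocal L N H w) : GL (Fin N) ℂ) : Matrix (Fin N) (Fin N) ℂ).det = 1 := by
  constructor
  · intro hg w
    rw [archPiEquivCM_apply, ← coe_archPlaceChar_cmArchDet L N H hH g w, hg, map_one, Circle.coe_one]
  · intro hg
    apply archPlaceChars_injective L
    funext w
    rw [archPlaceChars_apply, map_one, Pi.one_apply]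
    apply Circle.ext
    rw [coe_archPlaceChar_cmArchDet' L N H hH g w, Circle.coe_one, ← archPiEquivCM_apply]
    exact hg ⟨w, IsTotallyComplex.isComplex w⟩

/-- **From the place-wise shape to `hker`.** If `χ` kills every `a` all of whose complex components have
determinant `1` (the output shape of the place-by-place perfectness argument), then `χ` is trivial on
`ker det_∞`. [cite: BorelJacquet1979, §4.1] -/
theorem forall_map_eq_one_of_cmArchDet_eq_one {A : Type*} [Monoid A] (hH : H.det ≠ 0)
    (χ : arch (↥(maximalRealSubfield L)) L (IsCMField.complexConj L) N H →* A)
    (hSU : ∀ a : arch (↥(maximalRealSubfield L)) L (IsCMField.complexConj L) N H,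
      (∀ w : {w : InfinitePlace L // IsComplex w},
        (((archPiEquivCM N L H a w : archLocal L N H w) : GL (Fin N) ℂ) : Matrix (Fin N) (Fin N) ℂ).det = 1) →
          χ a = 1) :
    ∀ g, cmArchDet L N H hH g = 1 → χ g = 1 :=
  fun g hg => hSU g ((cmArchDet_eq_one_iff L N H hH g).1 hg)

/-- **Continuity from the centre, place-wise form.** An abstract homomorphism `χ : U(H)(L ⊗ ℝ) →* A` into a
topological monoid which kills every element all of whose complex components have determinant `1`, and whose
restriction to the centre is continuous, factors as `χ = α ∘ det_∞` with `α` CONTINUOUS, and is continuous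
(`N ≠ 0`, `det H ≠ 0`). [cite: Bourbaki1995, Ch. I §3 no. 4 Prop. 6] -/
theorem exists_continuous_comp_cmArchDet_eq' {A : Type*} [Monoid A] [TopologicalSpace A] (hH : H.det ≠ 0)
    (hN : N ≠ 0) (χ : arch (↥(maximalRealSubfield L)) L (IsCMField.complexConj L) N H →* A)
    (hSU : ∀ a : arch (↥(maximalRealSubfield L)) L (IsCMField.complexConj L) N H,
      (∀ w : {w : InfinitePlace L // IsComplex w},
        (((archPiEquivCM N L H a w : archLocal L N H w) : GL (Fin N) ℂ) : Matrix (Fin N) (Fin N) ℂ).det = 1) →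
          χ a = 1)
    (hcen : Continuous fun y => χ (cmArchCenter L N H y)) :
    ∃ α : relNormOneInfUnits (↥(maximalRealSubfield L)) L →* A,
      Continuous α ∧ χ = α.comp (cmArchDet L N H hH) :=
  exists_continuous_comp_cmArchDet_eq L N H hH hN χ (forall_map_eq_one_of_cmArchDet_eq_one L N H hH χ hSU) hcen

/-- **Continuity from the centre, place-wise form** (continuity of `χ` itself).
[cite: Bourbaki1995, Ch. I §3 no. 4 Prop. 6] -/
theorem continuous_of_forall_det_eq_one {A : Type*} [Monoid A] [TopologicalSpace A] (hH : H.det ≠ 0)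
    (hN : N ≠ 0) (χ : arch (↥(maximalRealSubfield L)) L (IsCMField.complexConj L) N H →* A)
    (hSU : ∀ a : arch (↥(maximalRealSubfield L)) L (IsCMField.complexConj L) N H,
      (∀ w : {w : InfinitePlace L // IsComplex w},
        (((archPiEquivCM N L H a w : archLocal L N H w) : GL (Fin N) ℂ) : Matrix (Fin N) (Fin N) ℂ).det = 1) →
          χ a = 1)
    (hcen : Continuous fun y => χ (cmArchCenter L N H y)) : Continuous χ :=
  continuous_of_trivial_on_ker_cmArchDet L N H hH hN χ (forall_map_eq_one_of_cmArchDet_eq_one L N H hH χ hSU) hcen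

end CM

end UnitaryGroup

end Literature.NumberTheory.Automorphic

end
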